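import Mathlib
import HarnessLib
import Summits.HubbardSuperconductivity.HubbardSuperconductivity.Theorems.KLProgrammeKLRegimeVolumeLimitV11HmisCovZeroOfTowerP
import Summits.HubbardSuperconductivity.HubbardSuperconductivity.Theorems.KLProgrammeKLRegimeTwoVolumeTowerStepCovEntryTwoFrame
import Summits.HubbardSuperconductivity.HubbardSuperconductivity.Theorems.KLProgrammeKLRegimeVolumeLimitV11TowerDataWOfGridMSplit
import Summits.HubbardSuperconductivity.HubbardSuperconductivity.Theorems.KLProgrammeKLRegimeVolumeLimitV11TowerDataWOfTwoAtoms

/-!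
# Route `KLProgramme` — crux K3, VL child (stmt-HubbardSuperconductivity-20440): THE ATOM `HmisCov` IS A THEOREM UNDER THE TOWER, and the window-key data
# stub `stub_vl_towerData` (v12W-2) reads **HE1 ⊕ producer** only
# (seat p3 g19; suppliers: p3's `…TwoVolumeTowerStepCovZeroTwoFrame` / `…VolumeLimitV11HmisCovZeroOfTowerP` (scale `0`), `…TwoVolumeTowerStepCovEntryTwoFrame`
# (entry sups of every step), k3c4-p1 g17's `hmisCovRowsPos_of_towerP` (rows/columns `1 ≤ j < n_β`) through `hmisCov_of_entry_zero_rows` and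
# `stub_vl_towerDataW_WF2_of_gridM_split`, p3 g18's `hgridM_of_towerV17F2` (Hgrid‴))

* §1 **`hmisEntry_of_towerP`** — the binder `HmisEntry` of `…V11TowerDataWOfGridMSplit.stub_vl_towerDataW_WF2_of_gridM_split`, for every `(G,P,Q,R)` with
  `R.WF2` (no door is used: any `c ≤ 1`, `U ≤ 1`): `sE j L = 𝒞(j)·cst/L` with `cst` the tower's increment numerator (`|e_{K_{bL}} − e_{K_L}| ≤ cst/L`,
  k3c4-p2 g11's `incrementData_twoVolume_of_towerV17F2'`), `𝒞(0) = 𝒞ₑ` (`norm_klStepCov_zero_sub_apply_le_unif`), `𝒞(m+1) = 𝒞(m,d)`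
  (`norm_klStepCov_succ_sub_apply_le_unif`, `d` = sup `|bgmCutoffSq′|`); uniform in `b` and `M`, `→ 0`.
* §2 **`hmisZero_of_towerP`** — the binder `HmisZero` (rows/columns of the scale-`0` step), read off `hmisCovZero_of_towerP`.
* §3 **`hmisCov_of_towerP`** — the binder `HmisCov` of `…V11TowerDataWOfGridMCov.stub_vl_towerDataW_WF2_of_gridM_cov` for every `(G,P,Q,R)` with `R.WF2`
  (`hmisCov_of_entry_zero_rows` ∘ §1 ∘ §2; rows/columns `j ≥ 1` = k3c4-p1's theorem).
* §4 **`stub_vl_towerDataW_WF2_of_HE1`** — `stub_vl_towerData` (v12W-2 image 2b393e9903c921f0) from **HE1 ⊕ producer**: the INTERFACE OF RECORD under the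
  window key after this file (Hgrid‴ = p3 g18's `hgridM_of_towerV17F2`, HmisEntry/HmisZero = §1/§2).

Proofs only; no definition; nothing asserts HE1, the producer, any stub, K3, VL or superconductivity.  [cite: BenfattoGiulianiMastropietro2006, §2.7-§2.9 and §3]
-/

noncomputable section

namespace Summit.HubbardSuperconductivity.HubbardSuperconductivity.Theorems.TwoVolumeSource

set_option linter.dupNamespace false -- summit = problem name (single-conjunct summit), D-0017

open Finset Filter Topology Literature.MathematicalPhysics.QuantumLattice GrassmannAlgebra Literature.Probability.LatticeModels
  Literature.Probability.LatticeModels.BattleFederbush Literature.MathematicalPhysics.QuantumLattice.BandSectorCounting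
open Summit.HubbardSuperconductivity.HubbardSuperconductivity.Theorems.TwoPointAssembly
open Summit.HubbardSuperconductivity.HubbardSuperconductivity.Theorems.KLRegimeSplit
open Summit.HubbardSuperconductivity.HubbardSuperconductivity.Theorems.KLProgrammeLegKernels
open Summit.HubbardSuperconductivity.HubbardSuperconductivity.Theorems.EngineV8
open Summit.HubbardSuperconductivity.HubbardSuperconductivity.Theorems.TwoVolumeDefect
open Summit.HubbardSuperconductivity.HubbardSuperconductivity.Theorems.TorusFourierL2
open Summit.HubbardSuperconductivity.HubbardSuperconductivity.Theorems.PerturbedFermiCurve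
open Summit.HubbardSuperconductivity.HubbardSuperconductivity.Theorems.DispersionFlow
open scoped Real

/-! ## §1 The entry sups of every step under the tower -/

set_option maxHeartbeats 1600000 in -- long binders, per-step case split
/-- **`HmisEntry` IS A THEOREM UNDER THE TOWER** (see the module docstring). [cite: BenfattoGiulianiMastropietro2006, §2.8 (2.80), §3 (3.2)–(3.3)] -/
theorem hmisEntry_of_towerP (G : GeoConsts) (P : SplitConsts) (Q : EngConsts) (R : RenConsts) (hR2 : R.WF2) :
    ∃ c₇ : ℝ, 0 < c₇ ∧ ∀ c : ℝ, 0 < c → c ≤ c₇ → ∃ U₇ : ℝ, 0 < U₇ ∧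
      ∀ μ ∈ klWindowC, ∀ U : ℝ, 0 < U → U ≤ U₇ → ∀ β : ℝ, klBetaMin ≤ β → β ≤ Real.exp (c / U ^ 2) →
        ∀ (K : TrigPolyC4v) (Lstar : ℕ) (Mstar : ℕ → ℕ), TowerP klPredsV17F2 G P Q R β U μ K Lstar Mstar →
        ∃ sE : ℕ → ℕ → ℝ, (∀ j L, 0 ≤ sE j L) ∧ (∀ j, Tendsto (sE j) atTop (𝓝 0)) ∧
        ∃ L₂ : ℕ, ∃ M₂ : ℕ → ℕ → ℕ, ∀ (L b M : ℕ) [NeZero L] [NeZero (b * L)] [NeZero M], L₂ ≤ L → M₂ L b ≤ M →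
          ∀ j, j < nScales β → ∀ x y, ‖(klStepCov (b * L) M β μ (klFlowFrameU (b * L) M β U μ (nScales β + 1)) j - klStepCov (b * L) M β μ (klFlowFrameU L M β U μ (nScales β + 1)) j) x y‖ ≤ sE j L := by
  classical
  have he : (0 : ℝ) < klE0 := by norm_num [klE0]
  obtain ⟨d, hd0, hd1, -, -, -⟩ := exists_abs_derivs4_bgmCutoffSq_le he
  refine ⟨1, one_pos, fun c hc _ => ⟨1, one_pos, fun μ hμ U hU _ β hβmin hβc K Lstar Mstar hT => ?_⟩⟩
  have hβ1 : 1 ≤ β := le_trans (by norm_num [klBetaMin]) hβmin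
  have hn1 : 1 ≤ nScales β + 1 := Nat.le_add_left 1 _
  -- the tower's increment numerator at order `0` and a majorant `cst ≥ 1`
  set Ac : ℝ := ∑ m ∈ range (nScales β + 1), 4 * (2 * klFlowDeg m + 1) * (1 + 4 * klFlowDeg m) ^ 0 * Q.CL β m with hAc
  set cst : ℝ := |Ac| + 1 with hcst
  have hcst1 : 1 ≤ cst := by have := abs_nonneg Ac; linarith
  have hcst0 : 0 < cst := lt_of_lt_of_le one_pos hcst1
  have hAc_le : Ac ≤ cst := by have := le_abs_self Ac; linarith
  -- the per-step constants
  have hΛpos : ∀ n, 0 < klScale klE0 n := fun n => klth_klScale_pos n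
  set Ce : ℝ := 2 * (klScale klE0 1 / π + 3) * (1793 * klScale klE0 1 + 704) * ((16 * (32 / 3) + 16) / klScale klE0 2 ^ 2) with hCe
  set Cs : ℕ → ℝ := fun m => (klScale klE0 (m + 2) / π + 3) * (1793 * klScale klE0 (m + 2) + 704) *
      (2 * (16 * (32 / 3) + 16) / klScale klE0 (m + 3) ^ 2 + 8 * d * (16 : ℝ) ^ m * (2 * klE0 + 1) / klScale klE0 (m + 3)) with hCs
  have hCe0 : 0 ≤ Ce := by have := hΛpos 1; have := hΛpos 2; simp only [hCe]; positivity
  have hCs0 : ∀ m, 0 ≤ Cs m := fun m => by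
    have := hΛpos (m + 2); have := hΛpos (m + 3); simp only [hCs]; positivity
  set coef : ℕ → ℝ := fun j => if j = 0 then Ce else Cs (j - 1) with hcoef
  have hcoef0 : ∀ j, 0 ≤ coef j := fun j => by
    simp only [hcoef]
    split_ifs
    · exact hCe0
    · exact hCs0 _
  refine ⟨fun j L => coef j * cst / L, fun j L => div_nonneg (mul_nonneg (hcoef0 j) hcst0.le) (Nat.cast_nonneg _),
    fun j => tendsto_const_div_atTop_nhds_zero_nat (coef j * cst), max Lstar (⌈cst⌉₊ + 1),
    fun L b => max (max (Mstar L) (Mstar (b * L))) (max (Q.M0 β L) (Q.M0 β (b * L))), fun L b M _ _ _ hL hM => ?_⟩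
  -- one instance
  dsimp only at hL hM
  have hLs : Lstar ≤ L := by omega
  have hLc : ⌈cst⌉₊ + 1 ≤ L := by omega
  have hMs : Mstar L ≤ M := by omega
  have hMsb : Mstar (b * L) ≤ M := by omega
  have hMQ : Q.M0 β L ≤ M := by omega
  have hMQb : Q.M0 β (b * L) ≤ M := by omega
  have hb1 : 1 ≤ b := Nat.pos_of_ne_zero fun hb => NeZero.ne (b * L) (by rw [hb, Nat.zero_mul])
  have hLbL : L ≤ b * L := Nat.le_mul_of_pos_left L hb1
  have hL0 : (0 : ℝ) < L := Nat.cast_pos.2 (Nat.pos_of_ne_zero (NeZero.ne L))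
  have hcstL : cst ≤ L := by
    have h1 : cst ≤ ⌈cst⌉₊ := Nat.le_ceil _
    have h2 : ((⌈cst⌉₊ : ℕ) : ℝ) + 1 ≤ L := by exact_mod_cast hLc
    linarith
  -- the two flow frames and the zeroth increment
  have hhL := histP_top_of_towerP hT hLs hMs
  have hhb := histP_top_of_towerP hT (hLs.trans hLbL) hMsb
  have hK : FrameOK R U (nScales β) μ (klFlowFrameU L M β U μ (nScales β + 1)) := frameOK_klFlowFrameU_of_histP_le hR2 hn1 le_rfl le_rfl hhL
  have hKb : FrameOK R U (nScales β) μ (klFlowFrameU (b * L) M β U μ (nScales β + 1)) :=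
    frameOK_klFlowFrameU_of_histP_le hR2 hn1 le_rfl le_rfl hhb
  obtain ⟨hΔ0, -, -, -⟩ := incrementData_twoVolume_of_towerV17F2' hμ hT hLs hLbL hMs hMQ hMsb hMQb (n := nScales β + 1) le_rfl
  have hP₀ : ∀ p : Momentum, |frameLevel μ (klFlowFrameU (b * L) M β U μ (nScales β + 1)) p - frameLevel μ (klFlowFrameU L M β U μ (nScales β + 1)) p| ≤
      cst / L := fun p => (hΔ0 p).trans (div_le_div_of_nonneg_right hAc_le hL0.le)
  have hP0 : 0 ≤ cst / L := by positivity
  have hP1 : cst / L ≤ 1 := by rw [div_le_one hL0]; exact hcstL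
  intro j hj x y
  cases j with
  | zero =>
    have h := norm_klStepCov_zero_sub_apply_le_unif (V := b * L) (M := M) hK hKb hβ1 hP0 hP₀ x y
    have e : coef 0 * cst / L = Ce * (cst / L) := by simp only [hcoef, if_pos rfl]; ring
    show _ ≤ coef 0 * cst / L
    rw [e]
    exact h
  | succ m =>
    have h := norm_klStepCov_succ_sub_apply_le_unif (V := b * L) (M := M) hK hKb hβ1 hd0 hd1 m hP0 hP1 hP₀ x y
    have e : coef (m + 1) * cst / L = Cs m * (cst / L) := by
      simp only [hcoef, Nat.add_one_ne_zero, if_false, Nat.add_sub_cancel]; ring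
    show _ ≤ coef (m + 1) * cst / L
    rw [e]
    exact h

/-! ## §2 The scale-`0` rows and columns under the tower -/

set_option maxHeartbeats 800000 in -- long binders
/-- **`HmisZero` IS A THEOREM UNDER THE TOWER**: read off `hmisCovZero_of_towerP` (which also carries the scale-`0` entries).
[cite: BenfattoGiulianiMastropietro2006, §2.8 (2.80)–(2.81), §3 (3.2)–(3.3)] -/
theorem hmisZero_of_towerP (G : GeoConsts) (P : SplitConsts) (Q : EngConsts) (R : RenConsts) (hR2 : R.WF2) :
    ∃ c₇ : ℝ, 0 < c₇ ∧ ∀ c : ℝ, 0 < c → c ≤ c₇ → ∃ U₇ : ℝ, 0 < U₇ ∧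
      ∀ μ ∈ klWindowC, ∀ U : ℝ, 0 < U → U ≤ U₇ → ∀ β : ℝ, klBetaMin ≤ β → β ≤ Real.exp (c / U ^ 2) →
        ∀ (K : TrigPolyC4v) (Lstar : ℕ) (Mstar : ℕ → ℕ), TowerP klPredsV17F2 G P Q R β U μ K Lstar Mstar →
        ∃ cR₀ cC₀ : ℕ → ℝ, (∀ L, 0 ≤ cR₀ L ∧ 0 ≤ cC₀ L ∧ cR₀ L ≤ 1 ∧ cC₀ L ≤ 1) ∧ (Tendsto cR₀ atTop (𝓝 0) ∧ Tendsto cC₀ atTop (𝓝 0)) ∧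
        ∃ L₂ : ℕ, ∃ M₂ : ℕ → ℕ → ℕ, ∀ (L b M : ℕ) [NeZero L] [NeZero (b * L)] [NeZero M], L₂ ≤ L → M₂ L b ≤ M → 0 < nScales β →
          (∀ x, ∑ y, ‖(klStepCov (b * L) M β μ (klFlowFrameU (b * L) M β U μ (nScales β + 1)) 0 - klStepCov (b * L) M β μ (klFlowFrameU L M β U μ (nScales β + 1)) 0) x y‖ ≤
            cR₀ L / imagTimeWeight β M) ∧
          (∀ y, ∑ x, ‖(klStepCov (b * L) M β μ (klFlowFrameU (b * L) M β U μ (nScales β + 1)) 0 - klStepCov (b * L) M β μ (klFlowFrameU L M β U μ (nScales β + 1)) 0) x y‖ ≤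
            cC₀ L / imagTimeWeight β M) := by
  obtain ⟨c₇, hc₇, h⟩ := hmisCovZero_of_towerP G P Q R hR2
  refine ⟨c₇, hc₇, fun c hc hcc => ?_⟩
  obtain ⟨U₇, hU₇, h'⟩ := h c hc hcc
  refine ⟨U₇, hU₇, fun μ hμ U hU hUU β hβmin hβc K Lstar Mstar hT => ?_⟩
  obtain ⟨sE, cR, cC, hsgn, hlim, L₂, M₂, hI⟩ := h' μ hμ U hU hUU β hβmin hβc K Lstar Mstar hT
  refine ⟨cR, cC, fun L => ⟨(hsgn L).2.1, (hsgn L).2.2.1, (hsgn L).2.2.2.1, (hsgn L).2.2.2.2⟩, ⟨hlim.2.1, hlim.2.2⟩, L₂, M₂,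
    fun L b M _ _ _ hL hM _ => ?_⟩
  obtain ⟨-, hr, hc'⟩ := hI L b M hL hM
  exact ⟨hr, hc'⟩

/-! ## §3 `HmisCov` is a theorem under the tower -/

set_option maxHeartbeats 800000 in -- long binders
/-- **THE ATOM `HmisCov` IS A THEOREM UNDER THE TOWER**: entries (§1), scale-`0` rows/columns (§2) and the rows/columns of the steps `1 ≤ j < n_β`
(k3c4-p1's `hmisCovRowsPos_of_towerP`) assembled by `hmisCov_of_entry_zero_rows`. [cite: BenfattoGiulianiMastropietro2006, §2.8 (2.80)–(2.81), §3 (3.2)–(3.8)] -/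
theorem hmisCov_of_towerP (G : GeoConsts) (P : SplitConsts) (Q : EngConsts) (R : RenConsts) (hG : G.WF) (hP : P.WF) (hQ : Q.WF) (hR2 : R.WF2) :
    ∃ c₇ : ℝ, 0 < c₇ ∧ ∀ c : ℝ, 0 < c → c ≤ c₇ → ∃ U₇ : ℝ, 0 < U₇ ∧
      ∀ μ ∈ klWindowC, ∀ U : ℝ, 0 < U → U ≤ U₇ → ∀ β : ℝ, klBetaMin ≤ β → β ≤ Real.exp (c / U ^ 2) →
        ∀ (K : TrigPolyC4v) (Lstar : ℕ) (Mstar : ℕ → ℕ), TowerP klPredsV17F2 G P Q R β U μ K Lstar Mstar →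
        ∃ (sE cR cC : ℕ → ℕ → ℝ),
          (∀ j L, 0 ≤ sE j L ∧ 0 ≤ cR j L ∧ 0 ≤ cC j L ∧ cR j L ≤ 1 ∧ cC j L ≤ 1) ∧
          (∀ j, Tendsto (sE j) atTop (𝓝 0) ∧ Tendsto (cR j) atTop (𝓝 0) ∧ Tendsto (cC j) atTop (𝓝 0)) ∧
        ∃ L₂ : ℕ, ∃ M₂ : ℕ → ℕ → ℕ, ∀ (L b M : ℕ) [NeZero L] [NeZero (b * L)] [NeZero M], L₂ ≤ L → M₂ L b ≤ M →
          (∀ j, j < nScales β → ∀ x y, ‖(klStepCov (b * L) M β μ (klFlowFrameU (b * L) M β U μ (nScales β + 1)) j - klStepCov (b * L) M β μ (klFlowFrameU L M β U μ (nScales β + 1)) j) x y‖ ≤ sE j L) ∧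
          (∀ j, j < nScales β → ∀ x, ∑ y, ‖(klStepCov (b * L) M β μ (klFlowFrameU (b * L) M β U μ (nScales β + 1)) j - klStepCov (b * L) M β μ (klFlowFrameU L M β U μ (nScales β + 1)) j) x y‖ ≤
            cR j L / imagTimeWeight β M) ∧
          (∀ j, j < nScales β → ∀ y, ∑ x, ‖(klStepCov (b * L) M β μ (klFlowFrameU (b * L) M β U μ (nScales β + 1)) j - klStepCov (b * L) M β μ (klFlowFrameU L M β U μ (nScales β + 1)) j) x y‖ ≤
            cC j L / imagTimeWeight β M) :=
  hmisCov_of_entry_zero_rows (fun G P Q R _ _ _ hR2 => hmisEntry_of_towerP G P Q R hR2) (fun G P Q R _ _ _ hR2 => hmisZero_of_towerP G P Q R hR2)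
    G P Q R hG hP hQ hR2

/-! ## §4 The window-key data stub from `HE1` and the producer -/

set_option maxHeartbeats 1600000 in -- long binders
/-- **`stub_vl_towerData` (v12W-2) FROM `HE1` AND THE PRODUCER TEXT ALONE**: `HmisEntry`, `HmisZero` (§1, §2) and `Hgrid‴` (p3 g18's `hgridM_of_towerV17F2`)
are theorems from the tower; the INTERFACE OF RECORD under the window key after this file is **HE1 ⊕ producer**.
[folklore: composition; cite: BenfattoGiulianiMastropietro2006, §2.7-§2.9 and §3] -/
theorem stub_vl_towerDataW_WF2_of_HE1
    (HE1 : ∀ (G : GeoConsts) (P : SplitConsts) (Q : EngConsts) (R : RenConsts), G.WF → P.WF → Q.WF → R.WF2 →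
      ∃ C₀ : ℝ, 0 ≤ C₀ ∧
        ∃ c₇ : ℝ, 0 < c₇ ∧ ∀ c : ℝ, 0 < c → c ≤ c₇ → ∃ U₇ : ℝ, 0 < U₇ ∧
          ∀ μ ∈ klWindowC, ∀ U : ℝ, 0 < U → U ≤ U₇ → ∀ β : ℝ, klBetaMin ≤ β → β ≤ Real.exp (c / U ^ 2) →
            ∀ (K : TrigPolyC4v) (Lstar : ℕ) (Mstar : ℕ → ℕ), TowerP klPredsV17F2 G P Q R β U μ K Lstar Mstar →
            ∃ S₀ : ℕ → ℕ → ℝ, (∀ j m, 0 ≤ S₀ j m) ∧ (∀ j, j ≤ nScales β → ∀ m, 1 ≤ m → S₀ j (2 * m) ≤ C₀ * klWtBudget P Q U (j + 1) (2 * m)) ∧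
            ∃ L₂ : ℕ, ∃ M₂ : ℕ → ℕ, ∀ (L M : ℕ) [NeZero L] [NeZero M], L₂ ≤ L → M₂ L ≤ M →
              (∀ k, k ≤ nScales β → hubbardEffPartitionFnCT L M β U μ 0 (klFlowFrameU L M β U μ (nScales β + 1)) (klScale klE0 (k + 1)) ≠ 0) ∧
              (∀ j, j ≤ nScales β → ∀ (m : ℕ) (q : Fin m) (w : SpaceTimeIdx L M × SectorLeg (sectorCount j)),
                klWtPinnedSumAt L M β μ (klFlowFrameU L M β U μ (nScales β + 1)) j j m (klEffectiveAction L M β U μ (klFlowFrameU L M β U μ (nScales β + 1)) klE0 (j + 1)) q w ≤ S₀ j m))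
    (hSrc : ∀ (P : SplitConsts) (R : RenConsts), P.WF → R.WF2 →
      ∃ Q' : EngConsts, 0 ≤ Q'.CE ∧ ∃ c₀ : ℝ, 0 < c₀ ∧ ∀ c : ℝ, 0 < c → c ≤ c₀ → ∃ U₀ : ℝ, 0 < U₀ ∧
        ∀ μ ∈ klWindowC, ∀ U : ℝ, 0 < U → U ≤ U₀ → ∀ β : ℝ, klBetaMin ≤ β → β ≤ Real.exp (c / U ^ 2) →
          ∃ A : ℕ → ℕ → ℝ, ∃ L₁ : ℕ, ∃ M₁ : ℕ → ℕ, ∀ (L M : ℕ) [NeZero L] [NeZero M], L₁ ≤ L → M₁ L ≤ M →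
            ∀ j : ℕ, j + 1 ≤ nScales β + 1 →
              SourceProfilesAtLev L M (klSrcBudget P Q' U A (j + 1)) β U μ (klFlowFrameU L M β U μ (nScales β + 1)) j j (j + 1))
    (G : GeoConsts) (P : SplitConsts) (Q : EngConsts) (R : RenConsts) (hG : G.WF) (hP : P.WF) (hQ : Q.WF) (hR2 : R.WF2) :
    ∃ c₅ : ℝ, 0 < c₅ ∧ ∀ c : ℝ, 0 < c → c ≤ c₅ → ∃ U₀ : ℝ, 0 < U₀ ∧
      ∀ μ ∈ klWindowC, ∀ U : ℝ, 0 < U → U ≤ U₀ → ∀ β : ℝ, klBetaMin ≤ β → β ≤ Real.exp (c / U ^ 2) →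
        ∀ K : TrigPolyC4v, klPredsV17F2.frameOK R U (nScales β) μ K →
          ∀ (Lstar : ℕ) (Mstar : ℕ → ℕ), TowerP klPredsV17F2 G P Q R β U μ K Lstar Mstar →
            ∃ t : ℝ, 0 < t ∧ t ≤ 1 ∧ Nonempty (TowerDataTSW β U μ t) :=
  stub_vl_towerDataW_WF2_of_gridM_split HE1 (fun G P Q R _ _ _ hR2 => hmisEntry_of_towerP G P Q R hR2)
    (fun G P Q R _ _ _ hR2 => hmisZero_of_towerP G P Q R hR2) (fun G P Q R _ _ _ hR2 => hgridM_of_towerV17F2 G P Q R hR2) hSrc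
    G P Q R hG hP hQ hR2

end Summit.HubbardSuperconductivity.HubbardSuperconductivity.Theorems.TwoVolumeSource

end
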